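import Literature.NumberTheory.Sieve.HeathBrownWeightClassSums
import HarnessLib

/-!
# Crude bounds for the residue-class counts of `x³ + 2y³`, PROVED

Topic `Literature/NumberTheory/Sieve`, namespace `Literature.NumberTheory.Sieve.CubicMinorant`
(`cubicClassCount d r = ν_d(r) = #{(a, b) mod d : a³ + 2b³ ≡ r}` of `HeathBrownWeightClassSums.lean`;
`coprimeClassWeight`, `classBoxPairs`, `pairBox` of the Heath-Brown–Moroz class files).

The elementary local bounds used in the TAIL of the dispersion argument for `n = p + (x³ + 2y³)`
(parity-ideate route `GoldbachHeathBrownDispersion`, crux ModelDispersion: the moduli `m = 2∏_{p∈t} p`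
beyond `Q₀`), all PROVED [HeathBrownMoroz2004, Lemma 2.4 (i) (local counts `≪ 3^{ω}`);
IrelandRosen1990, Ch. 8 §1 (a cubic congruence to a prime has at most three roots)]:

* `card_cubeRoots_le_three` — `#{a ∈ 𝔽_p : a³ = s} ≤ 3`;
* `cubicClassCount_eq_card_zmod`, `cubicClassCount_prime_le` — `ν_p(r) ≤ 3p`;
* `cubicClassCount_mul` (CRT) and **`cubicClassCount_prod_primes_le`** — `ν_m(r) ≤ 3^{#t} m` for
  `m = ∏_{p∈t} p` a product of distinct primes;
* **`card_pairBox_modEq_le`** — `#{(x,y) ∈ (A,A+L] × (A',A'+L] : x³+2y³ ≡ r (mod m)} ≤ ν_m(r)(L/m + 1)²`;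
* **`coprimeClassWeight_le_two_pow`** — `cw(m) = ∏_{p∣m}(p+1)/(p+1−ν_p) ≤ 2^{#primeFactors m}`.

No new facts. Written for the parity-ideate cell (literature seat g14, 2026-08-27).

## References

* [HeathBrownMoroz2004] D. R. Heath-Brown, B. Z. Moroz, *On primes represented by cubic polynomials*,
  Proc. LMS (3) 88 (2004), §2 Lemma 2.4 (i), §3 (3.1).
* [IrelandRosen1990] K. Ireland, M. Rosen, *A classical introduction to modern number theory*, Ch. 8 §1.

## Mathlib / tree search

Tree: `cubicClassCount`, `cubicClassCount_le` (`HeathBrownWeightClassSums`); `classBoxPairs`,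
`card_classBoxPairs_le`, `card_filter_box_eq_sum_classBoxPairs`, `value_modEq_of_mem_classBoxPairs`
(`CubicFormClassBrunTitchmarsh`); `coprimeClassWeight`, `cast_add_one_sub_cubeRootTwoCount_pos`,
`cubeRootTwoCount_le_three/_two/_three`. Mathlib: `Polynomial.card_roots'`, `ZMod.chineseRemainder`,
`Finset.card_nbij'`, `Finset.card_filter`, `Finset.sum_product`.
-/

noncomputable section

open Finset Polynomial
open Literature.NumberTheory.Sieve Literature.NumberTheory.Sieve.CubicPrimes

namespace Literature.NumberTheory.Sieve.CubicMinorant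

/-! ### At most three cube roots modulo a prime -/

/-- **A cubic congruence to a prime modulus has at most three solutions**: `#{a ∈ 𝔽_p : a³ = s} ≤ 3`.
[cite: IrelandRosen1990, Ch. 8 §1 (x^n = a over a finite field has at most n solutions)] -/
theorem card_cubeRoots_le_three {p : ℕ} [Fact p.Prime] (s : ZMod p) :
    #{a : ZMod p | a ^ 3 = s} ≤ 3 := by
  classical
  set f : (ZMod p)[X] := X ^ 3 - C s with hf
  have hf0 : f ≠ 0 := by
    rw [hf]
    exact X_pow_sub_C_ne_zero (by norm_num) s
  have hdeg : f.natDegree = 3 := by rw [hf, natDegree_X_pow_sub_C]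
  have hsub : (univ.filter fun a : ZMod p => a ^ 3 = s) ⊆ f.roots.toFinset := by
    intro a ha
    rw [mem_filter] at ha
    rw [Multiset.mem_toFinset, mem_roots hf0, IsRoot, hf, eval_sub, eval_pow, eval_X, eval_C, ha.2,
      sub_self]
  calc #{a : ZMod p | a ^ 3 = s} ≤ #f.roots.toFinset := card_le_card hsub
    _ ≤ Multiset.card f.roots := Multiset.toFinset_card_le _
    _ ≤ f.natDegree := card_roots' f
    _ = 3 := hdeg

/-! ### `ν_m(r)` through `ZMod m`, at primes, and multiplicativity -/

/-- `ν_m(r) = #{(x, y) ∈ (ℤ/m)² : x³ + 2y³ = r}`. [cite: HeathBrownMoroz2004, §3 (3.1)] -/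
theorem cubicClassCount_eq_card_zmod (m : ℕ) [NeZero m] (r : ℕ) :
    cubicClassCount m r = #{v : ZMod m × ZMod m | v.1 ^ 3 + 2 * v.2 ^ 3 = (r : ZMod m)} := by
  classical
  rw [cubicClassCount]
  refine Finset.card_nbij' (fun uv => ((uv.1 : ZMod m), (uv.2 : ZMod m)))
    (fun v => (v.1.val, v.2.val)) ?_ ?_ ?_ ?_
  · intro uv huv
    rw [mem_coe, mem_filter, mem_product, mem_range, mem_range] at huv
    simp only [mem_coe, mem_filter, mem_univ, true_and]
    have h := (ZMod.natCast_eq_natCast_iff' (uv.1 ^ 3 + 2 * uv.2 ^ 3) r m).mpr huv.2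
    push_cast at h
    exact h
  · intro v hv
    simp only [mem_coe, mem_filter, mem_univ, true_and] at hv
    rw [mem_coe, mem_filter, mem_product, mem_range, mem_range]
    refine ⟨⟨ZMod.val_lt v.1, ZMod.val_lt v.2⟩, ?_⟩
    rw [Nat.ModEq, ← ZMod.natCast_eq_natCast_iff']
    push_cast
    rw [ZMod.natCast_zmod_val, ZMod.natCast_zmod_val]
    exact hv
  · intro uv huv
    rw [mem_coe, mem_filter, mem_product, mem_range, mem_range] at huv
    simp only [ZMod.val_natCast_of_lt huv.1.1, ZMod.val_natCast_of_lt huv.1.2]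
  · intro v _
    simp only [ZMod.natCast_zmod_val]

/-- **`ν_p(r) ≤ 3p` at a prime** (for each `y`, at most three `x`). [cite: HeathBrownMoroz2004, Lemma 2.4 (i)] -/
theorem cubicClassCount_prime_le {p : ℕ} (hp : p.Prime) (r : ℕ) : cubicClassCount p r ≤ 3 * p := by
  classical
  haveI : Fact p.Prime := ⟨hp⟩
  rw [cubicClassCount_eq_card_zmod, card_filter, ← univ_product_univ, sum_product_right]
  calc ∑ y : ZMod p, ∑ x : ZMod p, (if (x, y).1 ^ 3 + 2 * (x, y).2 ^ 3 = (r : ZMod p) then 1 else 0)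
      = ∑ y : ZMod p, #{x : ZMod p | x ^ 3 = (r : ZMod p) - 2 * y ^ 3} := by
        refine sum_congr rfl fun y _ => ?_
        rw [card_filter]
        refine sum_congr rfl fun x _ => ?_
        simp only [eq_sub_iff_add_eq]
    _ ≤ ∑ _y : ZMod p, 3 := sum_le_sum fun y _ => card_cubeRoots_le_three _
    _ = 3 * p := by rw [sum_const, card_univ, ZMod.card, smul_eq_mul, mul_comm]

/-- **`ν` is multiplicative in the modulus** (Chinese remainder theorem in both coordinates):
`ν_{mn}(r) = ν_m(r) ν_n(r)` for coprime `m, n`. [cite: HeathBrownMoroz2004, Lemma 2.4 (multiplicativity of the local counts)] -/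
theorem cubicClassCount_mul {m n : ℕ} (hm : m ≠ 0) (hn : n ≠ 0) (h : m.Coprime n) (r : ℕ) :
    cubicClassCount (m * n) r = cubicClassCount m r * cubicClassCount n r := by
  classical
  haveI : NeZero m := ⟨hm⟩
  haveI : NeZero n := ⟨hn⟩
  haveI : NeZero (m * n) := ⟨mul_ne_zero hm hn⟩
  rw [cubicClassCount_eq_card_zmod, cubicClassCount_eq_card_zmod, cubicClassCount_eq_card_zmod,
    ← card_product]
  set ψ := ZMod.chineseRemainder h with hψ
  have hψr : ψ (r : ZMod (m * n)) = ((r : ZMod m), (r : ZMod n)) := by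
    rw [map_natCast]; rfl
  refine card_nbij' (fun v => (((ψ v.1).1, (ψ v.2).1), ((ψ v.1).2, (ψ v.2).2)))
    (fun w => (ψ.symm (w.1.1, w.2.1), ψ.symm (w.1.2, w.2.2))) ?_ ?_ ?_ ?_
  · intro v hv
    simp only [mem_coe, mem_filter, mem_univ, true_and] at hv
    simp only [mem_coe, mem_product, mem_filter, mem_univ, true_and]
    have key : ψ (v.1 ^ 3 + 2 * v.2 ^ 3) = ψ (r : ZMod (m * n)) := by rw [hv]
    rw [map_add, map_mul, map_pow, map_pow, map_ofNat, hψr] at key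
    have k1 := congr_arg Prod.fst key
    have k2 := congr_arg Prod.snd key
    simp only [Prod.fst_add, Prod.fst_mul, Prod.pow_fst, Prod.fst_ofNat,
      Prod.snd_add, Prod.snd_mul, Prod.pow_snd, Prod.snd_ofNat] at k1 k2
    exact ⟨k1, k2⟩
  · intro w hw
    simp only [mem_coe, mem_product, mem_filter, mem_univ, true_and] at hw
    simp only [mem_coe, mem_filter, mem_univ, true_and]
    apply ψ.injective
    rw [map_add, map_mul, map_pow, map_pow, map_ofNat, hψr, RingEquiv.apply_symm_apply,
      RingEquiv.apply_symm_apply]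
    ext
    · simp only [Prod.fst_add, Prod.fst_mul, Prod.pow_fst, Prod.fst_ofNat]; exact hw.1
    · simp only [Prod.snd_add, Prod.snd_mul, Prod.pow_snd, Prod.snd_ofNat]; exact hw.2
  · intro v _
    simp only [Prod.mk.eta, RingEquiv.symm_apply_apply]
  · intro w _
    simp only [RingEquiv.apply_symm_apply, Prod.mk.eta]

/-- **`ν_m(r) ≤ 3^{#t} m` for `m = ∏_{p∈t} p` a product of distinct primes.**
[cite: HeathBrownMoroz2004, Lemma 2.4 (i)] -/
theorem cubicClassCount_prod_primes_le {t : Finset ℕ} (ht : ∀ p ∈ t, p.Prime) (r : ℕ) :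
    cubicClassCount (∏ p ∈ t, p) r ≤ 3 ^ #t * ∏ p ∈ t, p := by
  classical
  induction t using Finset.induction_on with
  | empty =>
    simp only [prod_empty, card_empty, pow_zero, mul_one]
    exact (cubicClassCount_le 1 r).trans (by norm_num)
  | insert a s ha ih =>
    have hsa : ∀ p ∈ s, p.Prime := fun p hp => ht p (mem_insert_of_mem hp)
    have hap : a.Prime := ht a (mem_insert_self a s)
    rw [prod_insert ha, card_insert_of_notMem ha]
    have hcop : a.Coprime (∏ p ∈ s, p) :=
      Nat.Coprime.prod_right fun p hp => (Nat.coprime_primes hap (hsa p hp)).mpr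
        (fun h => ha (h ▸ hp))
    have hne : (∏ p ∈ s, p) ≠ 0 := prod_ne_zero_iff.mpr fun p hp => (hsa p hp).ne_zero
    rw [cubicClassCount_mul hap.ne_zero hne hcop]
    calc cubicClassCount a r * cubicClassCount (∏ p ∈ s, p) r
        ≤ (3 * a) * (3 ^ #s * ∏ p ∈ s, p) :=
          Nat.mul_le_mul (cubicClassCount_prime_le hap r) (ih hsa)
      _ = 3 ^ (#s + 1) * (a * ∏ p ∈ s, p) := by ring

/-! ### Box pairs in a residue class of values -/

/-- **Crude count of box pairs with `x³ + 2y³ ≡ r (mod m)`**: at most `ν_m(r) (L/m + 1)²` (split over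
the `ν_m(r)` classes of pairs `(a, b) mod m` with `a³ + 2b³ ≡ r`, each holding `≤ (L/m+1)²` box pairs).
[cite: HeathBrownMoroz2004, §3 (3.1)–(3.3)] -/
theorem card_pairBox_modEq_le {m : ℕ} (hm : 0 < m) (A A' L r : ℕ) :
    (#{xy ∈ Ioc A (A + L) ×ˢ Ioc A' (A' + L) | xy.1 ^ 3 + 2 * xy.2 ^ 3 ≡ r [MOD m]} : ℝ) ≤
      cubicClassCount m r * (((L : ℝ) / m + 1) ^ 2) := by
  rw [card_filter_box_eq_sum_classBoxPairs hm A A' L, Nat.cast_sum]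
  have hvanish : ∀ ab ∈ range m ×ˢ range m,
      (#{xy ∈ classBoxPairs A A' L m ab.1 ab.2 | xy.1 ^ 3 + 2 * xy.2 ^ 3 ≡ r [MOD m]} : ℝ) ≠ 0 →
        ab.1 ^ 3 + 2 * ab.2 ^ 3 ≡ r [MOD m] := by
    intro ab _ hne
    by_contra hab
    refine hne ?_
    rw [Nat.cast_eq_zero, card_eq_zero, filter_eq_empty_iff]
    intro xy hxy h
    exact hab ((value_modEq_of_mem_classBoxPairs hxy).symm.trans h)
  rw [← sum_filter_of_ne hvanish]
  have hgood : ∀ ab ∈ (range m ×ˢ range m).filter (fun ab : ℕ × ℕ => ab.1 ^ 3 + 2 * ab.2 ^ 3 ≡ r [MOD m]),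
      (#{xy ∈ classBoxPairs A A' L m ab.1 ab.2 | xy.1 ^ 3 + 2 * xy.2 ^ 3 ≡ r [MOD m]} : ℝ) ≤
        ((L : ℝ) / m + 1) ^ 2 := by
    intro ab _
    exact le_trans (by exact_mod_cast card_filter_le _ _) (card_classBoxPairs_le hm A A' L ab.1 ab.2)
  refine (sum_le_sum hgood).trans ?_
  rw [sum_const, nsmul_eq_mul, cubicClassCount]

/-! ### The class weight is at most `2^{ω(m)}` -/

/-- **`cw(m) ≤ 2^{#primeFactors m}`**: each factor `(p+1)/(p+1−ν_p)` is `≤ 2` (`ν_2 = ν_3 = 1`,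
`ν_p ≤ 3 ≤ (p+1)/2` for `p ≥ 5`). [cite: HeathBrownMoroz2004, Lemma 2.4 (i) with §3 (3.1)] -/
theorem coprimeClassWeight_le_two_pow (m : ℕ) : coprimeClassWeight m ≤ (2 : ℝ) ^ #m.primeFactors := by
  rw [coprimeClassWeight, ← prod_const]
  refine prod_le_prod (fun p hp => ?_) fun p hp => ?_
  · have hpp := Nat.prime_of_mem_primeFactors hp
    exact div_nonneg (by positivity) (cast_add_one_sub_cubeRootTwoCount_pos hpp).le
  · have hpp := Nat.prime_of_mem_primeFactors hp
    have hpos := cast_add_one_sub_cubeRootTwoCount_pos hpp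
    rw [div_le_iff₀ hpos]
    have hν3 : (cubeRootTwoCount p : ℝ) ≤ 3 := by exact_mod_cast cubeRootTwoCount_le_three hpp
    by_cases h5 : 5 ≤ p
    · have h5' : (5 : ℝ) ≤ p := by exact_mod_cast h5
      linarith
    · have hp' : p = 2 ∨ p = 3 := by
        have := hpp.two_le
        interval_cases p <;> simp_all (config := {decide := true})
      rcases hp' with rfl | rfl
      · rw [cubeRootTwoCount_two]; norm_num
      · rw [cubeRootTwoCount_three]; norm_num

/-! ### Cube roots to a square-free modulus and box pairs for large moduli

Appended 2026-08-27 (parity-ideate lit g14). For moduli `m` LARGER than the box side the class count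
`ν_m(r)(L/m + 1)²` above is useless (most classes are empty); counting instead, for each `y`, the
`x ∈ (A, A+L]` with `x³ ≡ r − 2y³ (mod m)` gives `#{box pairs : x³+2y³ ≡ r (m)} ≤ L·ρ₃(m)·(L/m + 1)` with
`ρ₃(m) = max_s #{a mod m : a³ ≡ s} ≤ 3^{ω(m)}` for square-free `m` [HeathBrownMoroz2004, Lemma 2.4 (i);
IrelandRosen1990, Ch. 8 §1]. -/

/-- `#{a < m : a³ ≡ s (mod m)} = #{x ∈ ℤ/m : x³ = s}`. [cite: IrelandRosen1990, Ch. 8 §1 (x^n = a over a finite field has at most n solutions)] -/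
theorem card_range_filter_cube_modEq_eq (m : ℕ) [NeZero m] (s : ℕ) :
    #{a ∈ range m | a ^ 3 ≡ s [MOD m]} = #{x : ZMod m | x ^ 3 = (s : ZMod m)} := by
  classical
  refine Finset.card_nbij' (fun a => (a : ZMod m)) (fun x => x.val) ?_ ?_ ?_ ?_
  · intro a ha
    rw [mem_coe, mem_filter, mem_range] at ha
    simp only [mem_coe, mem_filter, mem_univ, true_and]
    have h := (ZMod.natCast_eq_natCast_iff' (a ^ 3) s m).mpr ha.2
    push_cast at h
    exact h
  · intro x hx
    simp only [mem_coe, mem_filter, mem_univ, true_and] at hx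
    rw [mem_coe, mem_filter, mem_range]
    refine ⟨ZMod.val_lt x, ?_⟩
    rw [Nat.ModEq, ← ZMod.natCast_eq_natCast_iff']
    push_cast
    rw [ZMod.natCast_zmod_val]
    exact hx
  · intro a ha
    rw [mem_coe, mem_filter, mem_range] at ha
    simp only [ZMod.val_natCast_of_lt ha.1]
  · intro x _
    simp only [ZMod.natCast_zmod_val]

/-- **At most three cube roots to a prime modulus**: `#{a < p : a³ ≡ s (mod p)} ≤ 3`.
[cite: IrelandRosen1990, Ch. 8 §1 (x^n = a over a finite field has at most n solutions)] -/
theorem card_range_filter_cube_modEq_prime_le {p : ℕ} (hp : p.Prime) (s : ℕ) :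
    #{a ∈ range p | a ^ 3 ≡ s [MOD p]} ≤ 3 := by
  haveI : Fact p.Prime := ⟨hp⟩
  rw [card_range_filter_cube_modEq_eq]
  exact card_cubeRoots_le_three _

/-- **The number of cube roots is multiplicative in the modulus** (Chinese remainder theorem):
for coprime `m, n`, `#{a < mn : a³ ≡ s (mn)} = #{a < m : a³ ≡ s (m)} · #{a < n : a³ ≡ s (n)}`.
[cite: HeathBrownMoroz2004, Lemma 2.4 (multiplicativity of the local counts)] -/
theorem card_range_filter_cube_modEq_mul {m n : ℕ} (hm : m ≠ 0) (hn : n ≠ 0) (h : m.Coprime n)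
    (s : ℕ) :
    #{a ∈ range (m * n) | a ^ 3 ≡ s [MOD m * n]} =
      #{a ∈ range m | a ^ 3 ≡ s [MOD m]} * #{a ∈ range n | a ^ 3 ≡ s [MOD n]} := by
  classical
  haveI : NeZero m := ⟨hm⟩
  haveI : NeZero n := ⟨hn⟩
  haveI : NeZero (m * n) := ⟨mul_ne_zero hm hn⟩
  rw [card_range_filter_cube_modEq_eq, card_range_filter_cube_modEq_eq,
    card_range_filter_cube_modEq_eq, ← card_product]
  set ψ := ZMod.chineseRemainder h with hψ
  have hψs : ψ (s : ZMod (m * n)) = ((s : ZMod m), (s : ZMod n)) := by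
    rw [map_natCast]; rfl
  refine card_nbij' (fun x => ((ψ x).1, (ψ x).2)) (fun w => ψ.symm (w.1, w.2)) ?_ ?_ ?_ ?_
  · intro x hx
    simp only [mem_coe, mem_filter, mem_univ, true_and] at hx
    simp only [mem_coe, mem_product, mem_filter, mem_univ, true_and]
    have key : ψ (x ^ 3) = ψ (s : ZMod (m * n)) := by rw [hx]
    rw [map_pow, hψs] at key
    exact ⟨congr_arg Prod.fst key, congr_arg Prod.snd key⟩
  · intro w hw
    simp only [mem_coe, mem_product, mem_filter, mem_univ, true_and] at hw
    simp only [mem_coe, mem_filter, mem_univ, true_and]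
    apply ψ.injective
    rw [map_pow, hψs, RingEquiv.apply_symm_apply]
    ext
    · exact hw.1
    · exact hw.2
  · intro x _
    simp only [Prod.mk.eta, RingEquiv.symm_apply_apply]
  · intro w _
    simp only [RingEquiv.apply_symm_apply, Prod.mk.eta]

/-- **`#{a < m : a³ ≡ s (m)} ≤ 3^{#t}` for `m = ∏_{p∈t} p` a product of distinct primes.**
[cite: HeathBrownMoroz2004, Lemma 2.4 (i)] -/
theorem card_range_filter_cube_modEq_prod_primes_le {t : Finset ℕ} (ht : ∀ p ∈ t, p.Prime) (s : ℕ) :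
    #{a ∈ range (∏ p ∈ t, p) | a ^ 3 ≡ s [MOD ∏ p ∈ t, p]} ≤ 3 ^ #t := by
  classical
  induction t using Finset.induction_on with
  | empty =>
    simp only [prod_empty, card_empty, pow_zero]
    exact (card_filter_le _ _).trans (by simp)
  | insert a u ha ih =>
    have hsa : ∀ p ∈ u, p.Prime := fun p hp => ht p (mem_insert_of_mem hp)
    have hap : a.Prime := ht a (mem_insert_self a u)
    rw [prod_insert ha, card_insert_of_notMem ha]
    have hcop : a.Coprime (∏ p ∈ u, p) :=
      Nat.Coprime.prod_right fun p hp => (Nat.coprime_primes hap (hsa p hp)).mpr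
        (fun h => ha (h ▸ hp))
    have hne : (∏ p ∈ u, p) ≠ 0 := prod_ne_zero_iff.mpr fun p hp => (hsa p hp).ne_zero
    rw [card_range_filter_cube_modEq_mul hap.ne_zero hne hcop]
    calc #{x ∈ range a | x ^ 3 ≡ s [MOD a]} * #{x ∈ range (∏ p ∈ u, p) | x ^ 3 ≡ s [MOD ∏ p ∈ u, p]}
        ≤ 3 * 3 ^ #u := Nat.mul_le_mul (card_range_filter_cube_modEq_prime_le hap s) (ih hsa)
      _ = 3 ^ (#u + 1) := by ring

/-- **Integers of an interval with prescribed cube residue**: for `m ≥ 1`,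
`#{A < x ≤ A+L : x³ ≡ s (mod m)} ≤ #{a < m : a³ ≡ s (m)} · (L/m + 1)`.
[cite: HalberstamRichert1974, Thm 2.2 (the remainder `|R_d| ≤ 1` of an arithmetic progression)] -/
theorem card_Ioc_filter_cube_modEq_le {m : ℕ} (hm : 0 < m) (A L s : ℕ) :
    (#{x ∈ Ioc A (A + L) | x ^ 3 ≡ s [MOD m]} : ℝ) ≤
      #{a ∈ range m | a ^ 3 ≡ s [MOD m]} * ((L : ℝ) / m + 1) := by
  classical
  set I := (Ioc A (A + L)).filter (fun x : ℕ => x ^ 3 ≡ s [MOD m]) with hI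
  have hmaps : ∀ x ∈ I, x % m ∈ range m := fun x _ => mem_range.mpr (Nat.mod_lt x hm)
  rw [card_eq_sum_card_fiberwise hmaps, Nat.cast_sum]
  -- fibres over `a` with `a³ ≢ s` are empty; the others are progressions of `≤ L/m + 1` terms
  have hfib : ∀ a ∈ range m, (#{x ∈ I | x % m = a} : ℝ) ≤
      (if a ^ 3 ≡ s [MOD m] then (1 : ℝ) else 0) * ((L : ℝ) / m + 1) := by
    intro a _
    split_ifs with ha
    · rw [one_mul]
      have hsub : I.filter (fun x => x % m = a) ⊆ (Ioc A (A + L)).filter (fun x => x ≡ a [MOD m]) := by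
        intro x hx
        rw [mem_filter] at hx ⊢
        rw [hI, mem_filter] at hx
        refine ⟨hx.1.1, ?_⟩
        rw [Nat.ModEq, hx.2, Nat.mod_eq_of_lt (mem_range.mp ‹a ∈ range m›)]
      have h1 := (abs_le.mp (CubicPrimes.abs_card_Ioc_filter_modEq_sub_le hm A L a)).2
      calc (#{x ∈ I | x % m = a} : ℝ) ≤ #{x ∈ Ioc A (A + L) | x ≡ a [MOD m]} := by
            exact_mod_cast card_le_card hsub
        _ ≤ (L : ℝ) / m + 1 := by linarith
    · rw [zero_mul]
      have : I.filter (fun x => x % m = a) = ∅ := by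
        rw [filter_eq_empty_iff]
        intro x hx hxa
        rw [hI, mem_filter] at hx
        apply ha
        have hxm : x ≡ a [MOD m] := by rw [Nat.ModEq, hxa, Nat.mod_eq_of_lt (mem_range.mp ‹a ∈ range m›)]
        exact (hxm.pow 3).symm.trans hx.2
      rw [this, card_empty, Nat.cast_zero]
  refine (sum_le_sum hfib).trans ?_
  rw [← sum_mul, ← sum_filter, sum_const, nsmul_eq_mul, mul_one]

/-- `x³ + c ≡ r (mod m)` is a cube-residue condition `x³ ≡ s (mod m)` for a suitable `s < m` (`m ≥ 1`).
[folklore] -/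
private theorem exists_cube_add_modEq_iff {m : ℕ} (hm : 0 < m) (c r : ℕ) :
    ∃ s : ℕ, ∀ x : ℕ, (x ^ 3 + c ≡ r [MOD m] ↔ x ^ 3 ≡ s [MOD m]) := by
  haveI : NeZero m := ⟨hm.ne'⟩
  refine ⟨(((r : ZMod m) - c) : ZMod m).val, fun x => ?_⟩
  rw [Nat.ModEq, Nat.ModEq, ← ZMod.natCast_eq_natCast_iff', ← ZMod.natCast_eq_natCast_iff',
    ZMod.natCast_zmod_val]
  push_cast
  constructor
  · intro h; rw [← h]; ring
  · intro h; rw [h]; ring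

/-- **Box pairs in a residue class of values, for moduli of any size**: for `m = ∏_{p∈t} p` a product of
distinct primes, `#{(x,y) ∈ (A,A+L] × (A',A'+L] : x³ + 2y³ ≡ r (mod m)} ≤ L · 3^{#t} · (L/m + 1)`
(so `≤ 2·3^{#t} L` when `m > L`). [cite: HeathBrownMoroz2004, Lemma 2.4 (i) with §3 (3.1)–(3.3)] -/
theorem card_pairBox_modEq_le_of_prod_primes {t : Finset ℕ} (ht : ∀ p ∈ t, p.Prime) (A A' L r : ℕ) :
    (#{xy ∈ Ioc A (A + L) ×ˢ Ioc A' (A' + L) | xy.1 ^ 3 + 2 * xy.2 ^ 3 ≡ r [MOD ∏ p ∈ t, p]} : ℝ) ≤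
      (L : ℝ) * 3 ^ #t * ((L : ℝ) / (∏ p ∈ t, p : ℕ) + 1) := by
  classical
  set m := ∏ p ∈ t, p with hm
  have hm0 : 0 < m := prod_pos fun p hp => (ht p hp).pos
  -- sum over the second coordinate
  rw [card_filter, sum_product_right, Nat.cast_sum]
  have hy : ∀ y ∈ Ioc A' (A' + L),
      ((∑ x ∈ Ioc A (A + L), if (x, y).1 ^ 3 + 2 * (x, y).2 ^ 3 ≡ r [MOD m] then 1 else 0 : ℕ) : ℝ) ≤
        3 ^ #t * ((L : ℝ) / m + 1) := by
    intro y _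
    obtain ⟨s, hs⟩ := exists_cube_add_modEq_iff hm0 (2 * y ^ 3) r
    have hset : (∑ x ∈ Ioc A (A + L), if (x, y).1 ^ 3 + 2 * (x, y).2 ^ 3 ≡ r [MOD m] then 1 else 0 : ℕ) =
        #{x ∈ Ioc A (A + L) | x ^ 3 ≡ s [MOD m]} := by
      rw [card_filter]
      refine sum_congr rfl fun x _ => ?_
      simp only [hs x]
    rw [hset]
    refine (card_Ioc_filter_cube_modEq_le hm0 A L s).trans ?_
    refine mul_le_mul_of_nonneg_right ?_ (by positivity)
    exact_mod_cast card_range_filter_cube_modEq_prod_primes_le ht s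
  calc ∑ y ∈ Ioc A' (A' + L),
        ((∑ x ∈ Ioc A (A + L), if (x, y).1 ^ 3 + 2 * (x, y).2 ^ 3 ≡ r [MOD m] then 1 else 0 : ℕ) : ℝ)
      ≤ ∑ _y ∈ Ioc A' (A' + L), (3 : ℝ) ^ #t * ((L : ℝ) / m + 1) := sum_le_sum hy
    _ = (L : ℝ) * 3 ^ #t * ((L : ℝ) / m + 1) := by
        rw [sum_const, Nat.card_Ioc, Nat.add_sub_cancel_left, nsmul_eq_mul]
        ring

end Literature.NumberTheory.Sieve.CubicMinorant

end
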